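import Literature.NumberTheory.LFunctions.BCHDiagonalMeanSquareMVT
import Literature.NumberTheory.LFunctions.BCHDiagonalSum
import HarnessLib

/-!
# The BCH mean square, diagonal half in closed form:
# `∫_T^{2T} |A(½+it) Σ_{n ≤ √(t/2π)} n^{-1/2-it}|² dt = T Σ_{h,k} a_h ā_k/[h,k] (½ log(T/(2πM_{hk}²)) + γ + log 2 − ½) + O(B²(N² + N√T) log⁵)`

Topic `Literature/NumberTheory/LFunctions`. Everything in this file is PROVED (no named facts; the only
definition is the transparent main-term coefficient `BCH.diagMainCoeff`).

This file assembles the three landed pieces of the diagonal half of the Balasubramanian–Conrey–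
Heath-Brown mean square (named fact
`Literature.Barriers.RiemannHypothesis.BalasubramanianConreyHeathBrown1985_meanSquare`, route of
Titchmarsh §7.4 / Levinson 1974 §4 with activated lengths):

* `BCH.norm_meanSquare_sub_rawDiag_le` (`BCHDiagonalMeanSquareMVT.lean`): the activated mean value
  theorem, `∫_T^{2T}|A S_t|² = (raw diagonal) + O(4M(1+log M) B²(1+log N')(1+log N)³)`, `M = NN'`,
  `N' = ⌊√(T/π)⌋`;
* `BCH.sum_coincidence_diag_eq` (`BCHDiagonalReindex.lean`): raw diagonal
  `= Σ_{h,k} a_h ā_k/[h,k] · D_{N'/M_{hk}}(M_{hk}, T)`, `M_{hk} = max(h,k)/(h,k)`;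
* `BCH.abs_bchDiagSum_sub_le` (`BCHDiagonalSum.lean`):
  `D_L(M,T) = T(½ log(T/(2πM²)) + γ + log 2 − ½) + O(26πM²)`.

Results:

* `BCH.rawDiag_eq_sum_bchDiagSum` — the raw diagonal with its window integrals evaluated and
  reindexed: `Σ_{h,k ≤ N} a_h ā_k/[h,k] · D_{N'/M_{hk}}(M_{hk}, T)`;
* `BCH.sq_max_div_lcm_le` — `M_{hk}²/[h,k] ≤ h/k + k/h`, whence
  `Σ_{h,k ≤ N} M_{hk}²/[h,k] ≤ N(N+1)(1 + log N)` (`BCH.sum_sum_sq_max_div_lcm_le`): the `N² T^ε` of BCH;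
* `BCH.norm_meanSquare_sub_diagMain_le` — **the diagonal half in closed form**: for `T ≥ 2π`,
  `|a_h| ≤ B`,
  `‖∫_T^{2T}|A(½+it) S_t|² dt − Σ_{h,k ≤ N} a_h ā_k/[h,k] · T(½ log(T/(2πM_{hk}²)) + γ + log 2 − ½)‖`
  `  ≤ 26π B² N(N+1)(1 + log N) + 4NN'(1 + log NN') B² (1 + log N')(1 + log N)³`.

Twice the main term here plus the cross-term main term `T Σ a_h ā_k/[h,k] log(M_{hk}²/(h'k'))` is
`T Σ a_h ā_k/[h,k] (log(T(h,k)²/(2πhk)) + 2γ + 2 log 2 − 1) = T · 𝒬_T(a)`, the BCH main term in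
Radziwiłł's normalisation (`Literature.Barriers.RiemannHypothesis.bchQuadForm`).

## References

* [Titchmarsh1986] E. C. Titchmarsh, *The Theory of the Riemann Zeta-Function*, 2nd ed. (1986), §7.4.
* [Levinson1974] N. Levinson, Adv. Math. 13 (1974), 383–436, §4.
* [BettinChandeeRadziwill2017] S. Bettin, V. Chandee, M. Radziwiłł, J. reine angew. Math. 729 (2017),
  (1.2) (the target main term).
-/

noncomputable section

open Finset Real MeasureTheory Complex Set intervalIntegral
open scoped ComplexConjugate

namespace Literature.NumberTheory.LFunctions.BCH

/-! ### The reduced maximum `M_{hk} = max(h/(h,k), k/(h,k))` -/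

/-- The reduced maximum `M_{hk} = max(h/(h,k), k/(h,k))` of a pair (as a natural number).
[folklore] -/
def redMax (h k : ℕ) : ℕ := max (h / Nat.gcd h k) (k / Nat.gcd h k)

/-- Unfolding `redMax`. [folklore] -/
theorem redMax_def (h k : ℕ) : redMax h k = max (h / Nat.gcd h k) (k / Nat.gcd h k) := rfl

/-- `redMax h k ≥ 1` for `h ≥ 1`. [folklore] -/
theorem redMax_pos {h : ℕ} (k : ℕ) (hh : 0 < h) : 0 < redMax h k :=
  lt_of_lt_of_le (div_gcd_pos_left k hh) (le_max_left _ _)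

/-- `[h,k] = (h,k) · h' · k'` in `ℝ` (`h' = h/(h,k)`, `k' = k/(h,k)`). [folklore] -/
theorem lcm_cast_eq (h k : ℕ) :
    (Nat.lcm h k : ℝ) = (Nat.gcd h k : ℝ) * ((h / Nat.gcd h k : ℕ) : ℝ) * ((k / Nat.gcd h k : ℕ) : ℝ) := by
  have e : Nat.lcm h k = Nat.gcd h k * (h / Nat.gcd h k) * (k / Nat.gcd h k) := by
    have h1 : 1 * (k / Nat.gcd h k) * h = 1 * Nat.lcm h k := mul_div_gcd_mul_eq_lcm h k 1
    rw [one_mul, one_mul] at h1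
    calc Nat.lcm h k = k / Nat.gcd h k * h := h1.symm
      _ = k / Nat.gcd h k * (Nat.gcd h k * (h / Nat.gcd h k)) := by rw [gcd_mul_div_left h k]
      _ = Nat.gcd h k * (h / Nat.gcd h k) * (k / Nat.gcd h k) := by ring
  rw [e]
  push_cast
  ring

/-- **`M_{hk}²/[h,k] ≤ h/k + k/h`** for `h, k ≥ 1`: `max(h',k')² ≤ h'² + k'²` and `[h,k] = g h' k' ≥ h'k'`.
[folklore] -/
theorem sq_redMax_div_lcm_le {h k : ℕ} (hh : 0 < h) (hk : 0 < k) :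
    ((redMax h k : ℕ) : ℝ) ^ 2 / (Nat.lcm h k : ℝ) ≤ (h : ℝ) / k + (k : ℝ) / h := by
  set g := Nat.gcd h k with hg
  set h' := h / g with hh'
  set k' := k / g with hk'
  have hg0 : 0 < g := Nat.gcd_pos_of_pos_left k hh
  have hh'0 : 0 < h' := div_gcd_pos_left k hh
  have hk'0 : 0 < k' := div_gcd_pos_right h hk
  have hgR : (1 : ℝ) ≤ g := by exact_mod_cast hg0
  have hh'R : (0 : ℝ) < h' := by exact_mod_cast hh'0
  have hk'R : (0 : ℝ) < k' := by exact_mod_cast hk'0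
  have eh : (h : ℝ) = g * h' := by
    rw [hh', hg]; exact_mod_cast (gcd_mul_div_left h k).symm
  have ek : (k : ℝ) = g * k' := by
    rw [hk', hg]; exact_mod_cast (gcd_mul_div_right h k).symm
  have elcm : (Nat.lcm h k : ℝ) = g * h' * k' := lcm_cast_eq h k
  have hmax : ((redMax h k : ℕ) : ℝ) ^ 2 ≤ (h' : ℝ) ^ 2 + (k' : ℝ) ^ 2 := by
    rw [redMax_def]
    rcases le_total h' k' with hle | hle
    · rw [max_eq_right hle]; nlinarith [sq_nonneg (h' : ℝ)]
    · rw [max_eq_left hle]; nlinarith [sq_nonneg (k' : ℝ)]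
  have hratio : (h : ℝ) / k + (k : ℝ) / h = ((h' : ℝ) ^ 2 + (k' : ℝ) ^ 2) / (h' * k') := by
    have hg0' : (g : ℝ) ≠ 0 := by positivity
    rw [eh, ek, mul_div_mul_left _ _ hg0', mul_div_mul_left _ _ hg0', div_add_div _ _ hk'R.ne' hh'R.ne']
    ring
  rw [hratio, elcm]
  calc ((redMax h k : ℕ) : ℝ) ^ 2 / (g * h' * k')
      ≤ ((h' : ℝ) ^ 2 + (k' : ℝ) ^ 2) / (g * h' * k') :=
        div_le_div_of_nonneg_right hmax (by positivity)
    _ ≤ ((h' : ℝ) ^ 2 + (k' : ℝ) ^ 2) / (h' * k') := by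
        apply div_le_div_of_nonneg_left (by positivity) (by positivity)
        nlinarith [mul_pos hh'R hk'R]

/-- `Σ_{h,k ≤ N} (h/k + k/h) ≤ N(N+1)(1 + log N)`. [folklore] -/
theorem sum_sum_div_add_div_le (N : ℕ) :
    ∑ h ∈ Finset.Icc 1 N, ∑ k ∈ Finset.Icc 1 N, ((h : ℝ) / k + (k : ℝ) / h) ≤
      (N : ℝ) * (N + 1) * (1 + Real.log N) := by
  have hH : ∑ k ∈ Finset.Icc 1 N, (1 : ℝ) / k ≤ 1 + Real.log N := by
    rcases Nat.eq_zero_or_pos N with rfl | hN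
    · simp
    · have h := harmonic_le_one_add_log N
      have e : ((harmonic N : ℚ) : ℝ) = ∑ k ∈ Finset.Icc 1 N, (1 : ℝ) / k := by
        rw [harmonic_eq_sum_Icc]; push_cast
        exact Finset.sum_congr rfl fun r _ => by rw [one_div]
      rw [← e]; exact h
  have hS : ∑ h ∈ Finset.Icc 1 N, (h : ℝ) = (N : ℝ) * (N + 1) / 2 := sum_Icc_one_cast N
  have h1 : ∑ h ∈ Finset.Icc 1 N, ∑ k ∈ Finset.Icc 1 N, (h : ℝ) / k =
      (∑ h ∈ Finset.Icc 1 N, (h : ℝ)) * ∑ k ∈ Finset.Icc 1 N, (1 : ℝ) / k := by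
    rw [Finset.sum_mul]
    refine Finset.sum_congr rfl fun h _ => ?_
    rw [Finset.mul_sum]
    refine Finset.sum_congr rfl fun k _ => ?_
    ring
  have h2 : ∑ h ∈ Finset.Icc 1 N, ∑ k ∈ Finset.Icc 1 N, (k : ℝ) / h =
      (∑ k ∈ Finset.Icc 1 N, (k : ℝ)) * ∑ h ∈ Finset.Icc 1 N, (1 : ℝ) / h := by
    rw [Finset.sum_comm, Finset.sum_mul]
    refine Finset.sum_congr rfl fun k _ => ?_
    rw [Finset.mul_sum]
    refine Finset.sum_congr rfl fun h _ => ?_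
    ring
  have hsplit : ∑ h ∈ Finset.Icc 1 N, ∑ k ∈ Finset.Icc 1 N, ((h : ℝ) / k + (k : ℝ) / h) =
      2 * ((∑ h ∈ Finset.Icc 1 N, (h : ℝ)) * ∑ k ∈ Finset.Icc 1 N, (1 : ℝ) / k) := by
    rw [two_mul]
    conv_lhs => rw [show (∑ h ∈ Finset.Icc 1 N, ∑ k ∈ Finset.Icc 1 N, ((h : ℝ) / k + (k : ℝ) / h)) =
      (∑ h ∈ Finset.Icc 1 N, ∑ k ∈ Finset.Icc 1 N, (h : ℝ) / k) +
        ∑ h ∈ Finset.Icc 1 N, ∑ k ∈ Finset.Icc 1 N, (k : ℝ) / h by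
      rw [← Finset.sum_add_distrib]
      exact Finset.sum_congr rfl fun h _ => Finset.sum_add_distrib]
    rw [h1, h2]
  rw [hsplit, hS]
  have hN0 : (0 : ℝ) ≤ (N : ℝ) * (N + 1) / 2 := by positivity
  nlinarith [mul_le_mul_of_nonneg_left hH hN0]

/-- **`Σ_{h,k ≤ N} M_{hk}²/[h,k] ≤ N(N+1)(1 + log N)`** — the size of the `N²T^ε` remainder of the
diagonal. [folklore] -/
theorem sum_sum_sq_redMax_div_lcm_le (N : ℕ) :
    ∑ h ∈ Finset.Icc 1 N, ∑ k ∈ Finset.Icc 1 N, ((redMax h k : ℕ) : ℝ) ^ 2 / (Nat.lcm h k : ℝ) ≤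
      (N : ℝ) * (N + 1) * (1 + Real.log N) := by
  refine le_trans (Finset.sum_le_sum fun h hh => Finset.sum_le_sum fun k hk =>
    sq_redMax_div_lcm_le (Finset.mem_Icc.1 hh).1 (Finset.mem_Icc.1 hk).1) ?_
  exact sum_sum_div_add_div_le N

/-! ### The raw diagonal, windows evaluated and reindexed -/

/-- **The raw diagonal of the activated mean value theorem is `Σ_{h,k} a_h ā_k/[h,k] D_{N'/M}(M_{hk},T)`.**
For `T ≥ 0`: the window integrals are `(2T − max(T, 2π max(n,n')²))⁺`
(`BCH.integral_indicator_le_eq_max_complex`) and the coincidences reindex by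
`BCH.sum_coincidence_diag_eq`. [cite: Titchmarsh1986, §7.4] -/
theorem rawDiag_eq_sum_bchDiagSum (a : ℕ → ℂ) (N N' : ℕ) {T : ℝ} (hT : 0 ≤ T) :
    ∑ i ∈ Finset.Icc 1 N' ×ˢ Finset.Icc 1 N,
        ∑ j ∈ (Finset.Icc 1 N' ×ˢ Finset.Icc 1 N) with j.1 * j.2 = i.1 * i.2,
          diagCoeff a i * conj (diagCoeff a j) *
            ∫ t in T..(2 * T), (if 2 * π * ((i.1 : ℕ) : ℝ) ^ 2 ≤ t ∧ 2 * π * ((j.1 : ℕ) : ℝ) ^ 2 ≤ t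
              then (((1 : ℝ) : ℝ) : ℂ) else 0) =
      ∑ h ∈ Finset.Icc 1 N, ∑ k ∈ Finset.Icc 1 N,
        a h * conj (a k) / (Nat.lcm h k : ℂ) *
          ((bchDiagSum ((redMax h k : ℕ) : ℝ) T (N' / redMax h k) : ℝ) : ℂ) := by
  have hTT' : T ≤ 2 * T := by linarith
  have step : ∀ i j : ℕ × ℕ,
      (∫ t in T..(2 * T), (if 2 * π * ((i.1 : ℕ) : ℝ) ^ 2 ≤ t ∧ 2 * π * ((j.1 : ℕ) : ℝ) ^ 2 ≤ t
          then (((1 : ℝ) : ℝ) : ℂ) else 0)) =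
        ((max (2 * T - max T (max (2 * Real.pi * (i.1 : ℝ) ^ 2) (2 * Real.pi * (j.1 : ℝ) ^ 2))) 0
          : ℝ) : ℂ) :=
    fun i j => integral_indicator_le_eq_max_complex hTT' _ _
  simp_rw [step]
  rw [sum_coincidence_diag_eq]
  rfl

/-! ### The main term -/

/-- The main-term coefficient `T(½ log(T/(2πM²)) + γ + log 2 − ½)` of the diagonal sum `D(M, T)`
(half of the BCH kernel `log(T/(2πM²)) + 2γ + log 4 − 1` at the reduced maximum `M = M_{hk}`).
[cite: BettinChandeeRadziwill2017, (1.2)] -/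
def diagMainCoeff (M T : ℝ) : ℝ :=
  T * (Real.log (T / (2 * π * M ^ 2)) / 2 + Real.eulerMascheroniConstant + Real.log 2 - 1 / 2)

/-- Unfolding `diagMainCoeff`. [folklore] -/
theorem diagMainCoeff_def (M T : ℝ) : diagMainCoeff M T =
    T * (Real.log (T / (2 * π * M ^ 2)) / 2 + Real.eulerMascheroniConstant + Real.log 2 - 1 / 2) :=
  rfl

/-- The hypothesis of `BCH.abs_bchDiagSum_sub_le` at `L = N'/M`, `N' = ⌊√(T/π)⌋`: `πM²(L+1)² > T`.
[folklore] -/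
theorem lt_pi_mul_sq_mul_sq {T : ℝ} (hT : 0 ≤ T) {M : ℕ} (hM : 0 < M) :
    T < π * (M : ℝ) ^ 2 * (((⌊Real.sqrt (2 * T / (2 * π))⌋₊ / M : ℕ) : ℝ) + 1) ^ 2 := by
  set N' : ℕ := ⌊Real.sqrt (2 * T / (2 * π))⌋₊ with hN'
  have hπ := Real.pi_pos
  -- `√(T/π) < N' + 1 ≤ M (N'/M + 1)`
  have h1 : Real.sqrt (2 * T / (2 * π)) < (N' : ℝ) + 1 := Nat.lt_floor_add_one _
  have h2 : N' + 1 ≤ M * (N' / M + 1) := Nat.lt_mul_div_succ N' hM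
  have h3 : (N' : ℝ) + 1 ≤ (M : ℝ) * (((N' / M : ℕ) : ℝ) + 1) := by exact_mod_cast h2
  have h4 : Real.sqrt (2 * T / (2 * π)) < (M : ℝ) * (((N' / M : ℕ) : ℝ) + 1) := lt_of_lt_of_le h1 h3
  have h5 : 2 * T / (2 * π) < ((M : ℝ) * (((N' / M : ℕ) : ℝ) + 1)) ^ 2 := by
    have h0 : 0 ≤ Real.sqrt (2 * T / (2 * π)) := Real.sqrt_nonneg _
    calc 2 * T / (2 * π) = Real.sqrt (2 * T / (2 * π)) ^ 2 := (Real.sq_sqrt (by positivity)).symm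
      _ < ((M : ℝ) * (((N' / M : ℕ) : ℝ) + 1)) ^ 2 := by
          exact pow_lt_pow_left₀ h4 h0 two_ne_zero
  have e : 2 * T / (2 * π) = T / π := by field_simp
  rw [e, div_lt_iff₀ hπ] at h5
  nlinarith [h5]

/-- Pointwise size of one term of the main-term replacement. [folklore] -/
theorem norm_term_sub_le (a : ℕ → ℂ) {h k : ℕ} (hh : 0 < h) (hk : 0 < k) {T B : ℝ} (hT : 0 < T)
    (hBh : ‖a h‖ ≤ B) (hBk : ‖a k‖ ≤ B) (hB0 : 0 ≤ B) :
    ‖a h * conj (a k) / (Nat.lcm h k : ℂ) *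
        (((bchDiagSum ((redMax h k : ℕ) : ℝ) T (⌊Real.sqrt (2 * T / (2 * π))⌋₊ / redMax h k) -
            diagMainCoeff ((redMax h k : ℕ) : ℝ) T : ℝ)) : ℂ)‖ ≤
      B ^ 2 * (26 * π * (((redMax h k : ℕ) : ℝ) ^ 2 / (Nat.lcm h k : ℝ))) := by
  have hM : 0 < ((redMax h k : ℕ) : ℝ) := by exact_mod_cast redMax_pos k hh
  have hlcm : 0 < (Nat.lcm h k : ℝ) := by exact_mod_cast Nat.lcm_pos hh hk
  have hD := abs_bchDiagSum_sub_le hM hT (L := ⌊Real.sqrt (2 * T / (2 * π))⌋₊ / redMax h k)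
    (lt_pi_mul_sq_mul_sq hT.le (redMax_pos k hh))
  rw [← diagMainCoeff_def] at hD
  rw [norm_mul, norm_div, norm_mul, Complex.norm_conj, Complex.norm_natCast, Complex.norm_real,
    Real.norm_eq_abs]
  have h1 : ‖a h‖ * ‖a k‖ ≤ B * B :=
    mul_le_mul hBh hBk (norm_nonneg _) hB0
  have h2 : ‖a h‖ * ‖a k‖ / (Nat.lcm h k : ℝ) ≤ B * B / (Nat.lcm h k : ℝ) :=
    div_le_div_of_nonneg_right h1 hlcm.le
  calc ‖a h‖ * ‖a k‖ / (Nat.lcm h k : ℝ) *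
        |bchDiagSum ((redMax h k : ℕ) : ℝ) T (⌊Real.sqrt (2 * T / (2 * π))⌋₊ / redMax h k) -
          diagMainCoeff ((redMax h k : ℕ) : ℝ) T|
      ≤ B * B / (Nat.lcm h k : ℝ) * (26 * π * ((redMax h k : ℕ) : ℝ) ^ 2) :=
        mul_le_mul h2 hD (abs_nonneg _) (by positivity)
    _ = B ^ 2 * (26 * π * (((redMax h k : ℕ) : ℝ) ^ 2 / (Nat.lcm h k : ℝ))) := by
        field_simp

/-- **Replacing each diagonal sum by its main term** costs
`26π B² Σ M_{hk}²/[h,k] ≤ 26π B² N(N+1)(1+log N)`. [folklore] -/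
theorem norm_sum_bchDiagSum_sub_sum_main_le (a : ℕ → ℂ) (N : ℕ) {T B : ℝ} (hT : 0 < T)
    (hB : ∀ h ∈ Finset.Icc 1 N, ‖a h‖ ≤ B) :
    ‖∑ h ∈ Finset.Icc 1 N, ∑ k ∈ Finset.Icc 1 N,
        a h * conj (a k) / (Nat.lcm h k : ℂ) *
          ((bchDiagSum ((redMax h k : ℕ) : ℝ) T (⌊Real.sqrt (2 * T / (2 * π))⌋₊ / redMax h k) : ℝ) : ℂ) -
      ∑ h ∈ Finset.Icc 1 N, ∑ k ∈ Finset.Icc 1 N,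
        a h * conj (a k) / (Nat.lcm h k : ℂ) * ((diagMainCoeff ((redMax h k : ℕ) : ℝ) T : ℝ) : ℂ)‖ ≤
      26 * π * B ^ 2 * ((N : ℝ) * (N + 1) * (1 + Real.log N)) := by
  rcases Nat.eq_zero_or_pos N with rfl | hN
  · simp
  have hB0 : 0 ≤ B := le_trans (norm_nonneg _) (hB 1 (Finset.mem_Icc.2 ⟨le_rfl, hN⟩))
  rw [← Finset.sum_sub_distrib]
  have e : ∀ h ∈ Finset.Icc 1 N,
      (∑ k ∈ Finset.Icc 1 N, a h * conj (a k) / (Nat.lcm h k : ℂ) *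
          ((bchDiagSum ((redMax h k : ℕ) : ℝ) T (⌊Real.sqrt (2 * T / (2 * π))⌋₊ / redMax h k) : ℝ) : ℂ)) -
        ∑ k ∈ Finset.Icc 1 N, a h * conj (a k) / (Nat.lcm h k : ℂ) *
          ((diagMainCoeff ((redMax h k : ℕ) : ℝ) T : ℝ) : ℂ) =
      ∑ k ∈ Finset.Icc 1 N, a h * conj (a k) / (Nat.lcm h k : ℂ) *
        (((bchDiagSum ((redMax h k : ℕ) : ℝ) T (⌊Real.sqrt (2 * T / (2 * π))⌋₊ / redMax h k) -
            diagMainCoeff ((redMax h k : ℕ) : ℝ) T : ℝ)) : ℂ) := by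
    intro h _
    rw [← Finset.sum_sub_distrib]
    refine Finset.sum_congr rfl fun k _ => ?_
    rw [Complex.ofReal_sub, mul_sub]
  rw [Finset.sum_congr rfl e]
  calc ‖∑ h ∈ Finset.Icc 1 N, ∑ k ∈ Finset.Icc 1 N, a h * conj (a k) / (Nat.lcm h k : ℂ) *
        (((bchDiagSum ((redMax h k : ℕ) : ℝ) T (⌊Real.sqrt (2 * T / (2 * π))⌋₊ / redMax h k) -
            diagMainCoeff ((redMax h k : ℕ) : ℝ) T : ℝ)) : ℂ)‖
      ≤ ∑ h ∈ Finset.Icc 1 N, ‖∑ k ∈ Finset.Icc 1 N, a h * conj (a k) / (Nat.lcm h k : ℂ) *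
        (((bchDiagSum ((redMax h k : ℕ) : ℝ) T (⌊Real.sqrt (2 * T / (2 * π))⌋₊ / redMax h k) -
            diagMainCoeff ((redMax h k : ℕ) : ℝ) T : ℝ)) : ℂ)‖ := norm_sum_le _ _
    _ ≤ ∑ h ∈ Finset.Icc 1 N, ∑ k ∈ Finset.Icc 1 N, ‖a h * conj (a k) / (Nat.lcm h k : ℂ) *
        (((bchDiagSum ((redMax h k : ℕ) : ℝ) T (⌊Real.sqrt (2 * T / (2 * π))⌋₊ / redMax h k) -
            diagMainCoeff ((redMax h k : ℕ) : ℝ) T : ℝ)) : ℂ)‖ :=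
        Finset.sum_le_sum fun h _ => norm_sum_le _ _
    _ ≤ ∑ h ∈ Finset.Icc 1 N, ∑ k ∈ Finset.Icc 1 N,
          B ^ 2 * (26 * π * (((redMax h k : ℕ) : ℝ) ^ 2 / (Nat.lcm h k : ℝ))) :=
        Finset.sum_le_sum fun h hh => Finset.sum_le_sum fun k hk =>
          norm_term_sub_le a (Finset.mem_Icc.1 hh).1 (Finset.mem_Icc.1 hk).1 hT (hB h hh) (hB k hk) hB0
    _ = 26 * π * B ^ 2 * ∑ h ∈ Finset.Icc 1 N, ∑ k ∈ Finset.Icc 1 N,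
          ((redMax h k : ℕ) : ℝ) ^ 2 / (Nat.lcm h k : ℝ) := by
        rw [Finset.mul_sum]
        refine Finset.sum_congr rfl fun h _ => ?_
        rw [Finset.mul_sum]
        refine Finset.sum_congr rfl fun k _ => ?_
        ring
    _ ≤ 26 * π * B ^ 2 * ((N : ℝ) * (N + 1) * (1 + Real.log N)) :=
        mul_le_mul_of_nonneg_left (sum_sum_sq_redMax_div_lcm_le N) (by positivity)

/-! ### The diagonal half in closed form -/

/-- **The diagonal half of the BCH mean square, closed form.** For `T > 0`, `|a_h| ≤ B` (`h ≤ N`),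
`N' = ⌊√(T/π)⌋`, `M_{hk} = max(h,k)/(h,k)`:
`‖∫_T^{2T} |A(½+it)·Σ_{n ≤ ⌊√(t/2π)⌋} n^{-(½+it)}|² dt − Σ_{h,k ≤ N} a_h ā_k/[h,k] · T(½ log(T/(2πM_{hk}²)) + γ + log 2 − ½)‖`
`  ≤ 26π B² N(N+1)(1 + log N) + 4NN'(1 + log(NN')) B² (1 + log N')(1 + log N)³`.
For `N = T^θ`, `θ < ½`, `B = C(δ)N^δ` both remainders are `o(T)`, uniformly over the coefficient
class. [cite: BettinChandeeRadziwill2017, (1.2)] -/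
theorem norm_meanSquare_sub_diagMain_le (a : ℕ → ℂ) (N : ℕ) {T B : ℝ} (hT : 0 < T)
    (hB : ∀ h ∈ Finset.Icc 1 N, ‖a h‖ ≤ B) :
    ‖((∫ t in T..(2 * T),
          ‖(∑ k ∈ Finset.Icc 1 N, a k * (k : ℂ) ^ (-(((1 / 2 : ℝ) : ℂ) + t * I))) *
            (∑ n ∈ Finset.Icc 1 ⌊Real.sqrt (t / (2 * π))⌋₊,
              (n : ℂ) ^ (-(((1 / 2 : ℝ) : ℂ) + t * I)))‖ ^ 2 : ℝ) : ℂ) -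
        ∑ h ∈ Finset.Icc 1 N, ∑ k ∈ Finset.Icc 1 N,
          a h * conj (a k) / (Nat.lcm h k : ℂ) * ((diagMainCoeff ((redMax h k : ℕ) : ℝ) T : ℝ) : ℂ)‖ ≤
      26 * π * B ^ 2 * ((N : ℝ) * (N + 1) * (1 + Real.log N)) +
        2 * (2 * ((N * ⌊Real.sqrt (2 * T / (2 * π))⌋₊ : ℕ) : ℝ) *
            (1 + Real.log ((N * ⌊Real.sqrt (2 * T / (2 * π))⌋₊ : ℕ) : ℝ))) *
          (B ^ 2 * ((1 + Real.log (⌊Real.sqrt (2 * T / (2 * π))⌋₊ : ℕ)) * (1 + Real.log N) ^ 3)) := by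
  have h1 := norm_meanSquare_sub_rawDiag_le a N hT.le hB
  rw [rawDiag_eq_sum_bchDiagSum a N ⌊Real.sqrt (2 * T / (2 * π))⌋₊ hT.le] at h1
  simp only [redMax_def] at *
  have h2 := norm_sum_bchDiagSum_sub_sum_main_le a N hT hB
  simp only [redMax_def] at h2
  calc _ ≤ _ + _ := norm_sub_le_norm_sub_add_norm_sub _ _ _
    _ ≤ _ := by linarith [h1, h2]

end Literature.NumberTheory.LFunctions.BCH
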